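import Summits.QuantumFields.YangMills.Theorems.ConvexGribovBodyBrascampLiebVacuumSCFloorCentralInvolutionsOrbit
import Literature.MathematicalPhysics.QuantumLattice.GaugeGroupsProofs

/-!
# Crux `BrascampLiebVacuumSC` (stmt-QuantumFields-16404), line `SketchIdeator1`: the gauge-fixed floor
# WITHOUT the leak stub, for groups all of whose involutions are central — part II (assembly)

Helper file of the line lead (`prover-line-stmt-QuantumFields-16404-c1-0`); see part I
(`Theorems/ConvexGribovBodyBrascampLiebVacuumSCFloorCentralInvolutionsOrbit.lean`) for the story. This
part proves `floorCore_of_involutions_central`: for a compact simple `G` with `g² = 1 ⇒ g central`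
(e.g. `SU(2)`), a faithful unitary `r` and every `β` there is `d > 0` with, on EVERY torus `(2S+1)⁴`,
`S ≥ 1`,

`d ≤ ∫ sup_{h ∈ argmin coul(U,·)} L⁻³ Σ_{j,y} ‖A^h_j(y)‖²_F dμ_{β,S}`,

i.e. the conclusion of the skeleton's `floorCore_of_stubs` without `stub_leak` and without `β ≥ β₀`,
`S ≥ S₀`. Steps: a minimiser is a gauge, so `Σ_ℓ ‖A^{h₀}_ℓ‖²_F ≥ ¼ Σ_p Q(U_p)` (orbit functional below the
anti-Hermitian mass of `p` in the gauge `h₀`; each slice link lies in four slice plaquettes,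
`GaugeAlgebra.slice_sum_le`); each of the `3(2S+1)³` time-zero spatial plaquettes has
`E_μ[Q(U_p)] ≥ e^{−|β|B} e^{−|β|B} σ` (`CentralInvolutions.oneLink_floor`, freeing the first link of `p`);
integrate (`FloorAssembly.integrable_iSup_subtype` for the Berge integrand). Everything is proved.
-/

set_option autoImplicit false

open scoped BigOperators Topology Matrix
open Filter MeasureTheory ProbabilityTheory
open Literature.MathematicalPhysics.QuantumFieldTheory
open Summit.QuantumFields.YangMills.Cruxes.CovarianceBound.SupportWindow
  (froSq coulombF IsCoulMin gluon modeCov supCov wilson4)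

noncomputable section

namespace Summit.QuantumFields.YangMills.Theorems.BrascampLiebVacuumSC

open scoped ENNReal
open Summit.QuantumFields.YangMills.Theorems.BrascampLiebVacuum.Negative
open Summit.QuantumFields.YangMills.Theorems.BrascampLiebVacuumSC.Negative
open Summit.QuantumFields.YangMills.Cruxes.CovarianceBound.SupportWindow.SupMeasurable

/-! ### The floor for groups with central involutions -/

open CentralInvolutions GaugeAlgebra FloorAssembly in
/-- **The gauge-fixed floor without the leak stub, for groups all of whose involutions are central.**
For a compact simple `G` with `g² = 1 ⇒ g central` (e.g. `SU(2)`), a faithful unitary `r` and every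
`β` there is `d = d(G, r, β) > 0` such that on EVERY torus `(2S+1)⁴`, `S ≥ 1`,
`d ≤ ∫ sup_{h ∈ argmin coul(U,·)} L⁻³ Σ_{j,y} ‖A^h_j(y)‖²_F dμ_{β,S}` — the conclusion of the line's
`floorCore_of_stubs` (there for `β ≥ β₀`, `S ≥ S₀`, from four stubs including `stub_leak`), here
unconditional in `β` and `S`. Proof: for a minimiser `h₀`, `Σ_ℓ ‖A^{h₀}_ℓ‖²_F ≥ ¼ Σ_p Q(U_p)` (the
orbit functional of `exists_plaquetteOrbitFunctional` is below the anti-Hermitian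
mass of `p` in the gauge `h₀`; each slice link lies in four slice plaquettes,
`GaugeAlgebra.slice_sum_le`), and `E_μ[Q(U_p)] ≥ e^{−|β|B} e^{−|β|B} σ` for each of the `3(2S+1)³`
time-zero spatial plaquettes by the one-link freeing argument (`CentralInvolutions.oneLink_floor`,
the freed link being the first link of `p`, whose one-link Haar average of `Q` is `≥ σ` in every
background); `d = (3/4) e^{−2|β|B} σ`. [folklore] -/
theorem floorCore_of_involutions_central :
    ∀ (G : Type) [Group G] [TopologicalSpace G] [IsTopologicalGroup G] [CompactSpace G]
    [MeasurableSpace G] [BorelSpace G], IsCompactSimpleLieGroup G →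
    (∀ g : G, g * g = 1 → g ∈ Subgroup.center G) →
    ∀ (r : LatticeRep G) (β : ℝ), ∃ d : ℝ, 0 < d ∧ ∀ S : ℕ, 1 ≤ S →
      d ≤ ∫ U, (⨆ h : {h : Site 4 (2 * S + 1) → G // IsCoulMin r S U h},
        (∑ j : Fin 3, ∑ y : Fin 3 → ZMod (2 * S + 1), froSq (gluon r S U h.1 y j)) /
          ((2 * S + 1 : ℝ) ^ 3)) ∂(wilson4 r β S) := by
  intro G _ _ _ _ _ _ hG hJ r β
  classical
  obtain ⟨Q, σ, hσ, hQc, hQ0, hQN, hQle, hQσ⟩ := exists_plaquetteOrbitFunctional G hG hJ r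
  obtain ⟨B, hB0, hB⟩ := exists_wilsonAction_update_bound r
  set e : ℝ := Real.exp (-(|β| * B)) with he
  have he0 : 0 < e := Real.exp_pos _
  refine ⟨3 / 4 * (e * e * σ), by positivity, fun S hS => ?_⟩
  haveI : Fact (1 < 2 * S + 1) := ⟨by omega⟩
  haveI : SecondCountableTopology G :=
    (r.continuous.isClosedEmbedding r.injective).isEmbedding.secondCountableTopology
  set L3 : ℝ := (2 * S + 1 : ℝ) ^ 3 with hL3
  have hL3pos : 0 < L3 := by positivity
  -- shifts of sites commute
  have hsc : ∀ (x : Site 4 (2 * S + 1)) (i i' : Fin 4), (x.shift i').shift i = (x.shift i).shift i' :=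
    fun x i i' => by
      simp only [Site.shift, add_assoc, add_comm (Pi.single (M := fun _ => ZMod (2 * S + 1)) i' 1)]
  -- (1) the orbit functional of a plaquette is below its anti-Hermitian mass in any gauge `h`
  have hQgt : ∀ (U : GaugeConfig 4 (2 * S + 1) G) (h : Site 4 (2 * S + 1) → G)
      (x : Site 4 (2 * S + 1)) (i i' : Fin 4),
      Q (U (x, i), U (x.shift i, i'), U (x.shift i', i), U (x, i')) ≤
        froSq ((1 / 2 : ℂ) • (r.ρ (gaugeTransform h U (x, i)) -
          (r.ρ (gaugeTransform h U (x, i)))ᴴ)) +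
        froSq ((1 / 2 : ℂ) • (r.ρ (gaugeTransform h U (x.shift i, i')) -
          (r.ρ (gaugeTransform h U (x.shift i, i')))ᴴ)) +
        froSq ((1 / 2 : ℂ) • (r.ρ (gaugeTransform h U (x.shift i', i)) -
          (r.ρ (gaugeTransform h U (x.shift i', i)))ᴴ)) +
        froSq ((1 / 2 : ℂ) • (r.ρ (gaugeTransform h U (x, i')) -
          (r.ρ (gaugeTransform h U (x, i')))ᴴ)) := by
    intro U h x i i'
    have key := hQle (h x) (h (x.shift i)) (h ((x.shift i).shift i')) (h (x.shift i'))
      (U (x, i)) (U (x.shift i, i')) (U (x.shift i', i)) (U (x, i'))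
    have e3 : gaugeTransform h U (x.shift i', i) =
        h (x.shift i') * U (x.shift i', i) * (h ((x.shift i).shift i'))⁻¹ := by
      simp only [gaugeTransform, hsc]
    rw [e3]
    exact key
  -- (2) summed over the slice: `Σ_p Q(U_p) ≤ 4 Σ_ℓ ‖A^h_ℓ‖²` for every gauge `h`
  have hslice : ∀ (U : GaugeConfig 4 (2 * S + 1) G) (h : Site 4 (2 * S + 1) → G),
      (∑ y : Fin 3 → ZMod (2 * S + 1), ∑ j : Fin 3, ∑ k : Fin 3,
        if j < k then Q (U (Fin.cons 0 y, j.succ),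
          U (Site.shift (d := 4) (Fin.cons (0 : ZMod (2 * S + 1)) y) j.succ, k.succ),
          U (Site.shift (d := 4) (Fin.cons (0 : ZMod (2 * S + 1)) y) k.succ, j.succ),
          U (Fin.cons 0 y, k.succ)) else 0) ≤
      4 * ∑ j : Fin 3, ∑ y : Fin 3 → ZMod (2 * S + 1), froSq (gluon r S U h y j) := by
    intro U h
    have hP := slice_sum_le (Y := Fin 3 → ZMod (2 * S + 1)) (fun j => Pi.single j 1)
      (fun y j k => 4 * Q (U (Fin.cons 0 y, j.succ),
          U (Site.shift (d := 4) (Fin.cons (0 : ZMod (2 * S + 1)) y) j.succ, k.succ),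
          U (Site.shift (d := 4) (Fin.cons (0 : ZMod (2 * S + 1)) y) k.succ, j.succ),
          U (Fin.cons 0 y, k.succ)))
      (fun y j => froSq (gluon r S U h y j))
      (fun y j k => by
        have hb := hQgt U h (Fin.cons (0 : ZMod (2 * S + 1)) y) j.succ k.succ
        rw [cons_zero_shift_succ, cons_zero_shift_succ] at hb
        simp only [gluon]
        simp only [cons_zero_shift_succ]
        linarith)
    beta_reduce at hP
    have h4 : (∑ y : Fin 3 → ZMod (2 * S + 1), ∑ j : Fin 3, ∑ k : Fin 3,
        if j < k then 4 * Q (U (Fin.cons 0 y, j.succ),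
          U (Site.shift (d := 4) (Fin.cons (0 : ZMod (2 * S + 1)) y) j.succ, k.succ),
          U (Site.shift (d := 4) (Fin.cons (0 : ZMod (2 * S + 1)) y) k.succ, j.succ),
          U (Fin.cons 0 y, k.succ)) else 0) =
        4 * ∑ y : Fin 3 → ZMod (2 * S + 1), ∑ j : Fin 3, ∑ k : Fin 3,
        if j < k then Q (U (Fin.cons 0 y, j.succ),
          U (Site.shift (d := 4) (Fin.cons (0 : ZMod (2 * S + 1)) y) j.succ, k.succ),
          U (Site.shift (d := 4) (Fin.cons (0 : ZMod (2 * S + 1)) y) k.succ, j.succ),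
          U (Fin.cons 0 y, k.succ)) else 0 := by
      simp only [Finset.mul_sum, mul_ite, mul_zero]
    rw [h4] at hP
    linarith
  -- (3) the floor integrand dominates `Σ_p Q(U_p) / (4 L³)` pointwise (take a minimiser `h₀`)
  have hAmB : ∀ (U : GaugeConfig 4 (2 * S + 1) G) (h : Site 4 (2 * S + 1) → G),
      (∑ j : Fin 3, ∑ y : Fin 3 → ZMod (2 * S + 1), froSq (gluon r S U h y j)) ≤
        3 * r.N * L3 := by
    intro U h
    calc ∑ j : Fin 3, ∑ y : Fin 3 → ZMod (2 * S + 1), froSq (gluon r S U h y j)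
        ≤ ∑ _j : Fin 3, ∑ _y : Fin 3 → ZMod (2 * S + 1), (r.N : ℝ) :=
          Finset.sum_le_sum fun j _ => Finset.sum_le_sum fun y _ => froSq_gluon_le r S U h y j
      _ = 3 * r.N * L3 := by
          simp only [Finset.sum_const, Finset.card_univ, Fintype.card_fin, nsmul_eq_mul,
            card_slice, Nat.cast_ofNat, hL3]
          ring
  have hpt : ∀ U : GaugeConfig 4 (2 * S + 1) G,
      (∑ y : Fin 3 → ZMod (2 * S + 1), ∑ j : Fin 3, ∑ k : Fin 3,
        if j < k then Q (U (Fin.cons 0 y, j.succ),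
          U (Site.shift (d := 4) (Fin.cons (0 : ZMod (2 * S + 1)) y) j.succ, k.succ),
          U (Site.shift (d := 4) (Fin.cons (0 : ZMod (2 * S + 1)) y) k.succ, j.succ),
          U (Fin.cons 0 y, k.succ)) else 0) / (4 * L3) ≤
      ⨆ h : {h : Site 4 (2 * S + 1) → G // IsCoulMin r S U h},
        (∑ j : Fin 3, ∑ y : Fin 3 → ZMod (2 * S + 1), froSq (gluon r S U h.1 y j)) / L3 := by
    intro U
    obtain ⟨h₀, hh₀⟩ := exists_isCoulMin r S U
    have hbdd : BddAbove (Set.range fun h : {h : Site 4 (2 * S + 1) → G // IsCoulMin r S U h} =>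
        (∑ j : Fin 3, ∑ y : Fin 3 → ZMod (2 * S + 1), froSq (gluon r S U h.1 y j)) / L3) :=
      ⟨3 * r.N * L3 / L3, by
        rintro _ ⟨h, rfl⟩
        exact div_le_div_of_nonneg_right (hAmB U h.1) hL3pos.le⟩
    refine le_trans ?_ (le_ciSup hbdd ⟨h₀, hh₀⟩)
    dsimp only
    rw [div_le_div_iff₀ (by positivity) hL3pos]
    have h1 := hslice U h₀
    nlinarith [h1, hL3pos]
  -- (4) each time-zero spatial plaquette term has expectation `≥ e e σ` (one-link floor)
  have hplaq : ∀ (y : Fin 3 → ZMod (2 * S + 1)) (j k : Fin 3), j < k →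
      e * e * σ ≤ ∫ U, Q (U (Fin.cons 0 y, j.succ),
          U (Site.shift (d := 4) (Fin.cons (0 : ZMod (2 * S + 1)) y) j.succ, k.succ),
          U (Site.shift (d := 4) (Fin.cons (0 : ZMod (2 * S + 1)) y) k.succ, j.succ),
          U (Fin.cons 0 y, k.succ)) ∂(wilson4 r β S) := by
    intro y j k hjk
    set x₀ : Site 4 (2 * S + 1) := Fin.cons (0 : ZMod (2 * S + 1)) y with hx₀
    set i : Fin 4 := j.succ with hi
    set i' : Fin 4 := k.succ with hi'
    have hii' : i ≠ i' := by
      rw [hi, hi']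
      exact fun h => hjk.ne (Fin.succ_injective _ h)
    set l : Edge 4 (2 * S + 1) := (x₀, i) with hl
    have h2 : ((x₀.shift i, i') : Edge 4 (2 * S + 1)) ≠ l := by
      simp [hl, Prod.ext_iff, hii'.symm]
    have h3 : ((x₀.shift i', i) : Edge 4 (2 * S + 1)) ≠ l := by
      intro h
      have := congrArg (fun e : Edge 4 (2 * S + 1) => e.1 i') h
      simp [Site.shift, hl] at this
    have h4 : ((x₀, i') : Edge 4 (2 * S + 1)) ≠ l := by
      simp [hl, Prod.ext_iff, hii'.symm]
    refine oneLink_floor r β l (fun U g => hB (2 * S + 1) U l g)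
      (f := fun U : GaugeConfig 4 (2 * S + 1) G =>
        Q (U (x₀, i), U (x₀.shift i, i'), U (x₀.shift i', i), U (x₀, i')))
      (by fun_prop) (fun U => hQ0 _) (M := 4 * r.N) (fun U => hQN _) (fun x => ?_)
    have hu : ∀ g : G, Q (Function.update x l g (x₀, i), Function.update x l g (x₀.shift i, i'),
        Function.update x l g (x₀.shift i', i), Function.update x l g (x₀, i')) =
        Q (g, x (x₀.shift i, i'), x (x₀.shift i', i), x (x₀, i')) := fun g => by
      rw [show ((x₀, i) : Edge 4 (2 * S + 1)) = l from rfl, Function.update_self,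
        Function.update_of_ne h2, Function.update_of_ne h3, Function.update_of_ne h4]
    simp_rw [hu]
    exact hQσ _ _ _
  -- (5) integrate
  have hT : ∀ (y : Fin 3 → ZMod (2 * S + 1)) (j k : Fin 3),
      Continuous fun U : GaugeConfig 4 (2 * S + 1) G => if j < k then
        Q (U (Fin.cons 0 y, j.succ), U (Site.shift (d := 4) (Fin.cons (0 : ZMod (2 * S + 1)) y) j.succ, k.succ),
          U (Site.shift (d := 4) (Fin.cons (0 : ZMod (2 * S + 1)) y) k.succ, j.succ), U (Fin.cons 0 y, k.succ))
        else 0 := by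
    intro y j k
    by_cases hjk : j < k
    · simp only [if_pos hjk]
      fun_prop
    · simp only [if_neg hjk]
      exact continuous_const
  have hI : ∀ (y : Fin 3 → ZMod (2 * S + 1)) (j k : Fin 3),
      Integrable (fun U : GaugeConfig 4 (2 * S + 1) G => if j < k then
        Q (U (Fin.cons 0 y, j.succ), U (Site.shift (d := 4) (Fin.cons (0 : ZMod (2 * S + 1)) y) j.succ, k.succ),
          U (Site.shift (d := 4) (Fin.cons (0 : ZMod (2 * S + 1)) y) k.succ, j.succ), U (Fin.cons 0 y, k.succ))
        else 0) (wilson4 r β S) := fun y j k =>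
    (hT y j k).integrable_of_hasCompactSupport (HasCompactSupport.of_compactSpace _)
  have hQs_int : Integrable (fun U : GaugeConfig 4 (2 * S + 1) G =>
      (∑ y : Fin 3 → ZMod (2 * S + 1), ∑ j : Fin 3, ∑ k : Fin 3,
        if j < k then Q (U (Fin.cons 0 y, j.succ),
          U (Site.shift (d := 4) (Fin.cons (0 : ZMod (2 * S + 1)) y) j.succ, k.succ),
          U (Site.shift (d := 4) (Fin.cons (0 : ZMod (2 * S + 1)) y) k.succ, j.succ),
          U (Fin.cons 0 y, k.succ)) else 0) / (4 * L3)) (wilson4 r β S) :=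
    (integrable_finsetSum _ fun y _ => integrable_finsetSum _ fun j _ =>
      integrable_finsetSum _ fun k _ => hI y j k).div_const _
  have hF_int : Integrable (fun U : GaugeConfig 4 (2 * S + 1) G =>
      ⨆ h : {h : Site 4 (2 * S + 1) → G // IsCoulMin r S U h},
        (∑ j : Fin 3, ∑ y : Fin 3 → ZMod (2 * S + 1), froSq (gluon r S U h.1 y j)) / L3)
      (wilson4 r β S) :=
    integrable_iSup_subtype (wilson4 r β S) (isClosed_isCoulMin r S) (exists_isCoulMin r S)
      (f := fun U h => (∑ j : Fin 3, ∑ y : Fin 3 → ZMod (2 * S + 1), froSq (gluon r S U h y j)) / L3)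
      ((continuous_finsetSum _ fun j _ => continuous_finsetSum _ fun y _ =>
        continuous_froSq.comp (continuous_gluon r S y j)).div_const _)
      (fun U h => div_nonneg (Finset.sum_nonneg fun _ _ => Finset.sum_nonneg fun _ _ =>
        froSq_nonneg _) hL3pos.le)
      (fun U h => div_le_div_of_nonneg_right (hAmB U h) hL3pos.le)
  have hmono := integral_mono hQs_int hF_int hpt
  refine le_trans ?_ hmono
  rw [integral_div, integral_finsetSum _ fun y _ =>
    integrable_finsetSum _ fun j _ => integrable_finsetSum _ fun k _ => hI y j k]
  have hsum : 3 * (e * e * σ) * L3 ≤ ∑ y : Fin 3 → ZMod (2 * S + 1),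
      ∫ U, (∑ j : Fin 3, ∑ k : Fin 3,
        if j < k then Q (U (Fin.cons 0 y, j.succ),
          U (Site.shift (d := 4) (Fin.cons (0 : ZMod (2 * S + 1)) y) j.succ, k.succ),
          U (Site.shift (d := 4) (Fin.cons (0 : ZMod (2 * S + 1)) y) k.succ, j.succ),
          U (Fin.cons 0 y, k.succ)) else 0) ∂(wilson4 r β S) := by
    rw [hL3, ← sum_ite_lt_const S (e * e * σ)]
    refine Finset.sum_le_sum fun y _ => ?_
    rw [integral_finsetSum _ fun j _ => integrable_finsetSum _ fun k _ => hI y j k]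
    refine Finset.sum_le_sum fun j _ => ?_
    rw [integral_finsetSum _ fun k _ => hI y j k]
    refine Finset.sum_le_sum fun k _ => ?_
    by_cases hjk : j < k
    · simp only [if_pos hjk]
      exact hplaq y j k hjk
    · simp only [if_neg hjk, integral_zero, le_refl]
  rw [le_div_iff₀ (by positivity)]
  nlinarith [hsum, hL3pos]

/-! ### The hypothesis holds for `SU(2)`: an involution of `SU(2)` is `±1` -/

/-- In `SU(2)` every `g` with `g² = 1` is central: writing `g = [[a, b], [c, d]]`, `g² = 1` and
`det g = 1` force `b = c = 0` and `a = d` (if `a + d = 0` then `a² + bc = 1 = ad − bc` gives `0 = 2`),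
so `g` is the scalar matrix `a · 1`, which commutes with everything. [folklore] -/
theorem involutions_central_su2 :
    ∀ g : Matrix.specialUnitaryGroup (Fin 2) ℂ, g * g = 1 →
      g ∈ Subgroup.center (Matrix.specialUnitaryGroup (Fin 2) ℂ) := by
  intro g hg
  rw [Subgroup.mem_center_iff]
  intro h
  have hA : g.1 * g.1 = 1 := by
    have := congrArg Subtype.val hg
    simpa using this
  have hdet : g.1.det = 1 := (Matrix.mem_specialUnitaryGroup_iff.1 g.2).2
  rw [Matrix.det_fin_two] at hdet
  have e00 := congrFun (congrFun hA 0) 0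
  have e01 := congrFun (congrFun hA 0) 1
  have e10 := congrFun (congrFun hA 1) 0
  have e11 := congrFun (congrFun hA 1) 1
  simp only [Matrix.mul_apply, Fin.sum_univ_two, Matrix.one_apply_eq, Matrix.one_apply_ne, ne_eq,
    zero_ne_one, one_ne_zero, not_false_eq_true] at e00 e01 e10 e11
  -- `a + d ≠ 0`
  have had : g.1 0 0 + g.1 1 1 ≠ 0 := by
    intro had
    have h2 : (2 : ℂ) = 0 := by linear_combination -e00 - hdet + g.1 0 0 * had
    norm_num at h2
  have hb : g.1 0 1 = 0 := by
    have : g.1 0 1 * (g.1 0 0 + g.1 1 1) = 0 := by linear_combination e01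
    exact (mul_eq_zero.1 this).resolve_right had
  have hc : g.1 1 0 = 0 := by
    have : g.1 1 0 * (g.1 0 0 + g.1 1 1) = 0 := by linear_combination e10
    exact (mul_eq_zero.1 this).resolve_right had
  have haa : g.1 0 0 = g.1 1 1 := by
    have h1 : (g.1 0 0 - g.1 1 1) * (g.1 0 0 + g.1 1 1) = 0 := by
      linear_combination e00 - e11
    exact sub_eq_zero.1 ((mul_eq_zero.1 h1).resolve_right had)
  -- `g` is the scalar matrix `a • 1`
  have hscal : g.1 = g.1 0 0 • (1 : Matrix (Fin 2) (Fin 2) ℂ) := by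
    ext i j
    fin_cases i <;> fin_cases j <;> simp [hb, hc, haa]
  apply Subtype.ext
  change h.1 * g.1 = g.1 * h.1
  rw [hscal, Matrix.mul_smul, Matrix.smul_mul, mul_one, one_mul]

/-- **The floor for `SU(2)`**, every faithful unitary lattice representation, every `β`, every torus
`S ≥ 1` — unconditionally (admissibility of `SU(2)` is the tree's proved
`isSimpleCompactGroup_specialUnitaryGroup_holds`; involutions of `SU(2)` are central). [folklore] -/
theorem floorCore_su2 [MeasurableSpace (Matrix.specialUnitaryGroup (Fin 2) ℂ)]
    [BorelSpace (Matrix.specialUnitaryGroup (Fin 2) ℂ)]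
    (r : LatticeRep (Matrix.specialUnitaryGroup (Fin 2) ℂ)) (β : ℝ) :
    ∃ d : ℝ, 0 < d ∧ ∀ S : ℕ, 1 ≤ S →
      d ≤ ∫ U, (⨆ h : {h : Site 4 (2 * S + 1) → Matrix.specialUnitaryGroup (Fin 2) ℂ //
          IsCoulMin r S U h},
        (∑ j : Fin 3, ∑ y : Fin 3 → ZMod (2 * S + 1), froSq (gluon r S U h.1 y j)) /
          ((2 * S + 1 : ℝ) ^ 3)) ∂(wilson4 r β S) :=
  floorCore_of_involutions_central _
    (isCompactSimpleLieGroup_specialUnitaryGroup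
      Literature.MathematicalPhysics.QuantumLattice.isSimpleCompactGroup_specialUnitaryGroup_holds
      le_rfl)
    involutions_central_su2 r β

end Summit.QuantumFields.YangMills.Theorems.BrascampLiebVacuumSC

end
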